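import Summits.BirchSwinnertonDyer.BirchSwinnertonDyer.Theorems.EisensteinPrimesKatzLineFlatRegimes
import Summits.BirchSwinnertonDyer.Rank1Residual.X11b.CharacterSupply
import HarnessLib

/-!
# `λ`-RIGIDITY of the `p`-power-map functional equation over the WIDE receptacle `𝓞_{ℂ_p}⟦T⟧`:
# `L(Φ)·Q^p = L^p·Q(Φ)` (`Φ = (1+T)^p − 1`) forces `Q` and `L` to have the SAME first-unit index
# (helper file for crux `GoodLatticeBDPValue`, stmt-BirchSwinnertonDyer-19032, line `halves`, piece AN-F₂)

Seat `bsd-line-x1-p1-w4` (D-0154 width seat on crux 2 of route `EisensteinPrimes`, line `halves` v17;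
ideator card `Cruxes/GoodLatticeBDPValue/Lines/halves_anDS_split_idea11g4` rev 2, piece AN-F₂
`KatzLineDescentAt`, route (RIG): «different-period rigidity … the first-unit index is preserved
(Strassmann / Weierstrass preparation over `𝓞_{ℂ_p}⟦T⟧`: NOT in the tree)»). This file proves that
preservation WITHOUT Weierstrass preparation over the non-noetherian `𝓞_{ℂ_p}` and WITHOUT the descent
`s ∈ ℤ_p` of the period ratio. THEOREMS ONLY (elementary `p`-adic analysis; no definition, no named fact,
no `sorry`; imports no `Theses` module). `--supports stmt-BirchSwinnertonDyer-19032`.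

THE ARGUMENT. Two CGLS-type frames `Q` (over `𝓞_{ℂ_p}`) and `L` of one `θ_K` with different periods take,
at an anticyclotomic character of type `(n, −n)`, values differing by `c^n`; along the supply
`x_{k+1} = Φ(x_k)`, `n_{k+1} = p·n_k` this gives the functional equation `L(Φ)·Q^p = L^p·Q(Φ)` in
`𝓞_{ℂ_p}⟦T⟧` (cell bsd-cn100's device; for BDP frames `UniversalToricDescentBDPFlatMuTransfer` §1; for Katz
frames the sequel file). Suppose `Q` has first-unit index `m` and `L` has first-unit index `m'`
(`‖[T^m]Q‖ = 1`, `‖[T^i]Q‖ < 1` for `i < m`). (1) ORDERS: `Φ` has order `1` with leading coefficient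
`p ≠ 0`, so `ord₀ F(Φ) = ord₀ F` and the equation gives `ord₀ Q = ord₀ L`; in particular `Q(0) = 0 ⇔
L(0) = 0`. (2) COMMON ZEROS DIVIDE OUT (file `…KatzLineFlatFactor`): if `Q(z) = L(z) = 0` with `‖z‖ < 1`
then `Q = (T−z)Q₁`, `L = (T−z)L₁` with indices `m−1`, `m'−1` and the SAME equation — induction on `m`.
(3) NO COMMON ZERO, `Q(0), L(0) ≠ 0`: evaluate the equation along the `Φ`-orbit `y_j = (1+y)^{p^j} − 1 → 0`
of any point `y` of the open disc: `‖L(y_{j+1})‖·‖Q(y_j)‖^p = ‖L(y_j)‖^p·‖Q(y_{j+1})‖`. For large `j`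
the orbit is in the NEAR regime (`‖Q(y_j)‖ = ‖Q(0)‖`, `‖L(y_j)‖ = ‖L(0)‖`), which forces
`‖Q(0)‖ = ‖L(0)‖`, and then DOWNWARD induction along the orbit (a common zero on the orbit being excluded)
gives `‖Q(y)‖ = ‖L(y)‖` for EVERY `y`. (4) In the FAR regime `‖y‖ → 1` (points `y` with `y^N = p`,
`ℂ_p` algebraically closed) `‖Q(y)‖ = ‖y‖^m` and `‖L(y)‖ = ‖y‖^{m'}`; hence `m = m'`.

Companion files: `…KatzLineFlatFactor` (the division step (2), the near regime) and `…KatzLineFlatRegimes`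
(the far regime and far points (4), the orders (1)).
* §1 the orbit: `value_identity_of_powMap_identity`, **`norm_value_eq_of_powMap_identity`** (no common
  zero ⟹ `‖Q(y)‖ = ‖L(y)‖` on the open disc).
* §2 **`firstUnitCoeffAt_eq_of_powMap_identity`** — the `λ`-rigidity `m = m'`
  (and its no-common-zero case `…_of_no_common_zero`).

References: [Washington1997] §7.1 Prop. 7.2, §7.2 (the `p`-power map); [Cassels1986] Ch. 4 Lemma 2.1,
Thm. 4.1 (Strassmann); [Gouvea1993PadicNumbers] §5.6–5.7.
-/

set_option linter.dupNamespace false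
set_option autoImplicit false

noncomputable section

open scoped Classical Topology
open Filter PowerSeries Literature.NumberTheory.EllipticCurves
  Summit.BirchSwinnertonDyer.Rank1Residual Summit.BirchSwinnertonDyer.Rank1Residual.X11b

namespace Summit.BirchSwinnertonDyer.BirchSwinnertonDyer.Theorems.KatzLineRigidity

variable {p : ℕ} [hp : Fact p.Prime]

/-! ### §1 The orbit argument: no common zero forces `‖Q(y)‖ = ‖L(y)‖` -/

/-- **The evaluated functional equation**: at every `y` of the open disc, with `y' = (1+y)^p − 1`,
`L(y')·Q(y)^p = L(y)^p·Q(y')`. [cite: Washington1997, §7.2 (the p-power map)] -/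
theorem value_identity_of_powMap_identity {Q L : PowerSeries 𝓞_ℂ_[p]}
    (h : L.subst (((1 + X : PowerSeries 𝓞_ℂ_[p]) ^ p) - 1) * Q ^ p =
      L ^ p * Q.subst (((1 + X : PowerSeries 𝓞_ℂ_[p]) ^ p) - 1))
    {y q q' l l' : ℂ_[p]} (hy : ‖y‖ < 1) (hq : IntSeries.HasValueAt Q y q)
    (hq' : IntSeries.HasValueAt Q ((1 + y) ^ p - 1) q') (hl : IntSeries.HasValueAt L y l)
    (hl' : IntSeries.HasValueAt L ((1 + y) ^ p - 1) l') : l' * q ^ p = l ^ p * q' := by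
  have h1 : IntSeries.HasValueAt (L.subst (((1 + X : PowerSeries 𝓞_ℂ_[p]) ^ p) - 1) * Q ^ p) y
      (l' * q ^ p) :=
    intSeries_hasValueAt_mul hy (intSeries_hasValueAt_subst_powMap p hy hl')
      (intSeries_hasValueAt_pow hy hq p)
  have h2 : IntSeries.HasValueAt (L ^ p * Q.subst (((1 + X : PowerSeries 𝓞_ℂ_[p]) ^ p) - 1)) y
      (l ^ p * q') :=
    intSeries_hasValueAt_mul hy (intSeries_hasValueAt_pow hy hl p)
      (intSeries_hasValueAt_subst_powMap p hy hq')
  rw [h] at h1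
  exact h1.unique h2

/-- **Orbit rigidity of value norms.** Let `Q, L ∈ 𝓞_{ℂ_p}⟦T⟧` satisfy `L(Φ)·Q^p = L^p·Q(Φ)`, have
non-zero constant terms, and have NO common zero in the open unit disc. Then `‖Q(y)‖ = ‖L(y)‖` for every
`‖y‖ < 1`: along the orbit `y_j = (1+y)^{p^j} − 1 → 0` the evaluated equation reads
`‖L(y_{j+1})‖·‖Q(y_j)‖^p = ‖L(y_j)‖^p·‖Q(y_{j+1})‖`; in the near regime (large `j`) it gives
`‖Q(0)‖ = ‖L(0)‖`, and downward induction on `j` (a common zero on the orbit being excluded) gives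
`‖Q(y_j)‖ = ‖L(y_j)‖` down to `j = 0`. [cite: Washington1997, §7.2] [cite: Gouvea1993PadicNumbers, §5.7] -/
theorem norm_value_eq_of_powMap_identity {Q L : PowerSeries 𝓞_ℂ_[p]}
    (hQ0 : constantCoeff Q ≠ 0) (hL0 : constantCoeff L ≠ 0)
    (hno : ∀ z : ℂ_[p], ‖z‖ < 1 → IntSeries.HasValueAt Q z 0 → IntSeries.HasValueAt L z 0 → False)
    (h : L.subst (((1 + X : PowerSeries 𝓞_ℂ_[p]) ^ p) - 1) * Q ^ p =
      L ^ p * Q.subst (((1 + X : PowerSeries 𝓞_ℂ_[p]) ^ p) - 1))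
    {y q l : ℂ_[p]} (hy : ‖y‖ < 1) (hq : IntSeries.HasValueAt Q y q) (hl : IntSeries.HasValueAt L y l) :
    ‖q‖ = ‖l‖ := by
  -- the orbit and the values along it
  set o : ℕ → ℂ_[p] := fun j ↦ (1 + y) ^ p ^ j - 1 with ho_def
  have ho1 : ∀ j, ‖o j‖ < 1 := fun j ↦ norm_one_add_pow_sub_one_lt hy _
  have hostep : ∀ j, o (j + 1) = (1 + o j) ^ p - 1 := fun j ↦ by
    simp only [ho_def, add_sub_cancel, ← pow_mul, pow_succ]
  have ho0 : o 0 = y := by simp [ho_def]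
  have hoT : Tendsto o atTop (𝓝 0) := by
    have h1 : Tendsto (fun j : ℕ ↦ (1 + y) ^ p ^ j) atTop (𝓝 1) :=
      tendsto_pow_prime_pow_padicComplex (by simpa using hy)
    have h2 := h1.sub_const 1
    simpa [ho_def] using h2
  set ev : PowerSeries 𝓞_ℂ_[p] → ℂ_[p] → ℂ_[p] := fun F x ↦
    ∑' k : ℕ, ((coeff k F : 𝓞_ℂ_[p]) : ℂ_[p]) * x ^ k with hev
  have hval : ∀ (F : PowerSeries 𝓞_ℂ_[p]) (j : ℕ), IntSeries.HasValueAt F (o j) (ev F (o j)) :=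
    fun F j ↦ intSeries_hasValueAt_tsum F (ho1 j)
  set a : ℕ → ℝ := fun j ↦ ‖ev Q (o j)‖ with ha_def
  set b : ℕ → ℝ := fun j ↦ ‖ev L (o j)‖ with hb_def
  -- the evaluated functional equation along the orbit
  have hE : ∀ j, b (j + 1) * a j ^ p = b j ^ p * a (j + 1) := by
    intro j
    have hq' : IntSeries.HasValueAt Q ((1 + o j) ^ p - 1) (ev Q (o (j + 1))) := by
      rw [← hostep]; exact hval Q (j + 1)
    have hl' : IntSeries.HasValueAt L ((1 + o j) ^ p - 1) (ev L (o (j + 1))) := by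
      rw [← hostep]; exact hval L (j + 1)
    have := value_identity_of_powMap_identity h (ho1 j) (hval Q j) hq' (hval L j) hl'
    have hn := congrArg norm this
    simpa only [norm_mul, norm_pow, ha_def, hb_def] using hn
  -- the near regime: eventually `a j = ‖Q(0)‖`, `b j = ‖L(0)‖`
  set α : ℝ := ‖((constantCoeff Q : 𝓞_ℂ_[p]) : ℂ_[p])‖ with hα
  set β : ℝ := ‖((constantCoeff L : 𝓞_ℂ_[p]) : ℂ_[p])‖ with hβ
  have hα0 : 0 < α := norm_pos_iff.mpr (by exact_mod_cast hQ0)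
  have hβ0 : 0 < β := norm_pos_iff.mpr (by exact_mod_cast hL0)
  obtain ⟨J, hJ⟩ : ∃ J, ∀ j ≥ J, ‖o j‖ < min α β := by
    have hev' : ∀ᶠ j in atTop, ‖o j‖ < min α β := by
      have h0 := hoT.norm
      rw [norm_zero] at h0
      exact h0.eventually (gt_mem_nhds (lt_min hα0 hβ0))
    exact eventually_atTop.mp hev'
  have hnear : ∀ j ≥ J, a j = α ∧ b j = β := fun j hj ↦
    ⟨norm_value_eq_norm_constantCoeff (ho1 j).le ((hJ j hj).trans_le (min_le_left _ _)) (hval Q j),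
      norm_value_eq_norm_constantCoeff (ho1 j).le ((hJ j hj).trans_le (min_le_right _ _)) (hval L j)⟩
  -- `α = β`
  have hαβ : α = β := by
    have hEJ := hE J
    rw [(hnear J le_rfl).1, (hnear J le_rfl).2, (hnear (J + 1) (Nat.le_succ J)).1,
      (hnear (J + 1) (Nat.le_succ J)).2] at hEJ
    -- `β α^p = β^p α`
    have hp1 : p - 1 ≠ 0 := Nat.sub_ne_zero_of_lt hp.out.one_lt
    have h1 : α ^ (p - 1) = β ^ (p - 1) := by
      have hp' : p = (p - 1) + 1 := (Nat.sub_add_cancel hp.out.one_le).symm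
      rw [hp', pow_succ, pow_succ] at hEJ
      -- β * (α^(p-1) * α) = β^(p-1) * β * α
      have := mul_left_cancel₀ hβ0.ne' (show β * (α ^ (p - 1) * α) = β * (β ^ (p - 1) * α) by
        rw [hEJ]; ring)
      exact mul_right_cancel₀ hα0.ne' this
    exact (pow_left_inj₀ hα0.le hβ0.le hp1).mp h1
  -- downward induction along the orbit
  have hdown : ∀ d j : ℕ, J ≤ j + d → a j = b j := by
    intro d
    induction d with
    | zero =>
      intro j hj
      rw [add_zero] at hj
      rw [(hnear j hj).1, (hnear j hj).2, hαβ]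
    | succ d ih =>
      intro j hj
      have hj1 : a (j + 1) = b (j + 1) := ih (j + 1) (by omega)
      have hEj := hE j
      rw [hj1] at hEj
      -- `b (j+1) ≠ 0`: else a common zero at `o (j+1)`
      have hb1 : b (j + 1) ≠ 0 := by
        intro hb0
        have ha0 : a (j + 1) = 0 := by rw [hj1, hb0]
        have hQz : IntSeries.HasValueAt Q (o (j + 1)) 0 := by
          have := hval Q (j + 1); rwa [show ev Q (o (j + 1)) = 0 from norm_eq_zero.mp ha0] at this
        have hLz : IntSeries.HasValueAt L (o (j + 1)) 0 := by
          have := hval L (j + 1); rwa [show ev L (o (j + 1)) = 0 from norm_eq_zero.mp hb0] at this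
        exact hno (o (j + 1)) (ho1 _) hQz hLz
      have h2 : a j ^ p = b j ^ p := by
        have := mul_left_cancel₀ hb1 (show b (j + 1) * a j ^ p = b (j + 1) * b j ^ p by rw [hEj]; ring)
        exact this
      exact (pow_left_inj₀ (norm_nonneg _) (norm_nonneg _) hp.out.ne_zero).mp h2
  have h0 : a 0 = b 0 := hdown J 0 (by omega)
  simp only [ha_def, hb_def, ho0] at h0
  have hq0 : q = ev Q y := hq.unique (by rw [← ho0]; exact hval Q 0)
  have hl0 : l = ev L y := hl.unique (by rw [← ho0]; exact hval L 0)
  rw [hq0, hl0, h0]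

/-! ### §2 `λ`-rigidity -/

/-- A series with a coefficient of norm `1` is non-zero. [folklore] -/
theorem ne_zero_of_norm_coeff_eq_one {Q : PowerSeries 𝓞_ℂ_[p]} {m : ℕ}
    (hm : ‖((coeff m Q : 𝓞_ℂ_[p]) : ℂ_[p])‖ = 1) : Q ≠ 0 := by
  rintro rfl
  rw [map_zero, ZeroMemClass.coe_zero, norm_zero] at hm
  exact zero_ne_one hm

/-- **The no-common-zero case of `λ`-rigidity.** If `Q` (first-unit index `m`) and `L` (first-unit index
`m'`) satisfy `L(Φ)·Q^p = L^p·Q(Φ)` and have no common zero in the open unit disc, then `m = m'`: by the order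
identity both constant terms are non-zero (else `0` is a common zero), by §1 `‖Q(y)‖ = ‖L(y)‖` on the
disc, and at a far point this reads `‖y‖^m = ‖y‖^{m'}`. [cite: Washington1997, §7.1 Prop. 7.2, §7.2] -/
theorem firstUnitCoeffAt_eq_of_powMap_identity_of_no_common_zero {Q L : PowerSeries 𝓞_ℂ_[p]}
    {m m' : ℕ}
    (hQ : ‖((coeff m Q : 𝓞_ℂ_[p]) : ℂ_[p])‖ = 1 ∧ ∀ i < m, ‖((coeff i Q : 𝓞_ℂ_[p]) : ℂ_[p])‖ < 1)
    (hL : ‖((coeff m' L : 𝓞_ℂ_[p]) : ℂ_[p])‖ = 1 ∧ ∀ i < m', ‖((coeff i L : 𝓞_ℂ_[p]) : ℂ_[p])‖ < 1)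
    (h : L.subst (((1 + X : PowerSeries 𝓞_ℂ_[p]) ^ p) - 1) * Q ^ p =
      L ^ p * Q.subst (((1 + X : PowerSeries 𝓞_ℂ_[p]) ^ p) - 1))
    (hno : ∀ z : ℂ_[p], ‖z‖ < 1 → IntSeries.HasValueAt Q z 0 → IntSeries.HasValueAt L z 0 → False) :
    m = m' := by
  have hQne : Q ≠ 0 := ne_zero_of_norm_coeff_eq_one hQ.1
  have hLne : L ≠ 0 := ne_zero_of_norm_coeff_eq_one hL.1
  -- non-zero constant terms (else `0` is a common zero)
  have hiff := constantCoeff_eq_zero_iff_of_powMap_identity hQne hLne h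
  have hzero : ¬ (constantCoeff Q = 0 ∧ constantCoeff L = 0) := by
    rintro ⟨hQ0, hL0⟩
    refine hno 0 (by rw [norm_zero]; exact zero_lt_one) ?_ ?_
    · have := hasValueAt_zero Q; rwa [hQ0, ZeroMemClass.coe_zero] at this
    · have := hasValueAt_zero L; rwa [hL0, ZeroMemClass.coe_zero] at this
  have hQ0 : constantCoeff Q ≠ 0 := fun h0 ↦ hzero ⟨h0, hiff.mp h0⟩
  have hL0 : constantCoeff L ≠ 0 := fun h0 ↦ hzero ⟨hiff.mpr h0, h0⟩
  -- a far point for both series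
  obtain ⟨c₁, hc₁0, hc₁1, hc₁⟩ := exists_bound_lt_one (f := fun i ↦ ‖((coeff i Q : 𝓞_ℂ_[p]) : ℂ_[p])‖) hQ.2
  obtain ⟨c₂, hc₂0, hc₂1, hc₂⟩ := exists_bound_lt_one (f := fun i ↦ ‖((coeff i L : 𝓞_ℂ_[p]) : ℂ_[p])‖) hL.2
  obtain ⟨y, hy0, hy1, hyc⟩ :=
    exists_far_point (p := p) (le_max_of_le_left hc₁0) (max_lt hc₁1 hc₂1) (max m m')
  have hym : ‖y‖ ^ max m m' ≤ ‖y‖ ^ m := pow_le_pow_of_le_one hy0.le hy1.le (le_max_left _ _)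
  have hym' : ‖y‖ ^ max m m' ≤ ‖y‖ ^ m' := pow_le_pow_of_le_one hy0.le hy1.le (le_max_right _ _)
  have hfarQ : ∀ i < m, ‖((coeff i Q : 𝓞_ℂ_[p]) : ℂ_[p])‖ < ‖y‖ ^ m := fun i hi ↦
    lt_of_le_of_lt ((hc₁ i hi).trans (le_max_left _ _)) (hyc.trans_le hym)
  have hfarL : ∀ i < m', ‖((coeff i L : 𝓞_ℂ_[p]) : ℂ_[p])‖ < ‖y‖ ^ m' := fun i hi ↦
    lt_of_le_of_lt ((hc₂ i hi).trans (le_max_right _ _)) (hyc.trans_le hym')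
  obtain ⟨q, hq⟩ := intSeries_exists_hasValueAt Q hy1
  obtain ⟨l, hl⟩ := intSeries_exists_hasValueAt L hy1
  have hqn : ‖q‖ = ‖y‖ ^ m := norm_value_eq_pow_of_coeff_lt hy1 hQ.1 hfarQ hq
  have hln : ‖l‖ = ‖y‖ ^ m' := norm_value_eq_pow_of_coeff_lt hy1 hL.1 hfarL hl
  have heq : ‖q‖ = ‖l‖ := norm_value_eq_of_powMap_identity hQ0 hL0 hno h hy1 hq hl
  rw [hqn, hln] at heq
  by_contra hne
  rcases Nat.lt_or_gt_of_ne hne with hlt | hgt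
  · exact absurd heq (ne_of_gt (pow_lt_pow_right_of_lt_one₀ hy0 hy1 hlt))
  · exact absurd heq (ne_of_lt (pow_lt_pow_right_of_lt_one₀ hy0 hy1 hgt))

/-- **`λ`-RIGIDITY OF THE POWER-MAP FUNCTIONAL EQUATION over `𝓞_{ℂ_p}⟦T⟧.** If `Q` has its first unit
coefficient at `m`, `L` has its first unit coefficient at `m'`, and `L(Φ)·Q^p = L^p·Q(Φ)` with
`Φ = (1+T)^p − 1`, then `m = m'`. Induction on `m`: common zeros in the open disc divide out (file
`…KatzLineFlatFactor`: indices drop by one, the equation descends); with no common zero the previous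
theorem applies. No Weierstrass preparation over `𝓞_{ℂ_p}` is used.
[cite: Washington1997, §7.1 Prop. 7.2, §7.2] [cite: Cassels1986, Ch. 4 Lemma 2.1] -/
theorem firstUnitCoeffAt_eq_of_powMap_identity :
    ∀ (m : ℕ) {Q L : PowerSeries 𝓞_ℂ_[p]} {m' : ℕ},
      (‖((coeff m Q : 𝓞_ℂ_[p]) : ℂ_[p])‖ = 1 ∧ ∀ i < m, ‖((coeff i Q : 𝓞_ℂ_[p]) : ℂ_[p])‖ < 1) →
      (‖((coeff m' L : 𝓞_ℂ_[p]) : ℂ_[p])‖ = 1 ∧ ∀ i < m', ‖((coeff i L : 𝓞_ℂ_[p]) : ℂ_[p])‖ < 1) →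
      L.subst (((1 + X : PowerSeries 𝓞_ℂ_[p]) ^ p) - 1) * Q ^ p =
        L ^ p * Q.subst (((1 + X : PowerSeries 𝓞_ℂ_[p]) ^ p) - 1) → m = m' := by
  intro m
  induction m with
  | zero =>
    intro Q L m' hQ hL h
    -- `‖Q(0)‖ = 1`: `Q` has no zero in the open disc, so there is no common zero
    refine firstUnitCoeffAt_eq_of_powMap_identity_of_no_common_zero hQ hL h fun z hz hQz _ ↦ ?_
    have h0 : ‖((constantCoeff Q : 𝓞_ℂ_[p]) : ℂ_[p])‖ = 1 := by
      rw [← coeff_zero_eq_constantCoeff_apply]; exact hQ.1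
    have := norm_value_eq_norm_constantCoeff hz.le (by rw [h0]; exact hz) hQz
    rw [norm_zero, h0] at this
    exact zero_ne_one this
  | succ m ih =>
    intro Q L m' hQ hL h
    by_cases hcz : ∃ z : ℂ_[p], ‖z‖ < 1 ∧ IntSeries.HasValueAt Q z 0 ∧ IntSeries.HasValueAt L z 0
    · -- a common zero divides out; indices drop by one; induction
      obtain ⟨z, hz, hQz, hLz⟩ := hcz
      set z' : 𝓞_ℂ_[p] := ⟨z, Literature.NumberTheory.LFunctions.Dwork.mem_unitBall.mpr hz.le⟩ with hz'
      have hz'' : ‖(z' : ℂ_[p])‖ < 1 := hz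
      obtain ⟨Q₁, hQ₁⟩ := exists_eq_X_sub_C_mul_of_hasValueAt_zero (z := z') hz'' hQz
      obtain ⟨L₁, hL₁⟩ := exists_eq_X_sub_C_mul_of_hasValueAt_zero (z := z') hz'' hLz
      obtain ⟨-, hQ₁i⟩ := exists_firstUnitCoeffAt_of_X_sub_C_mul hz'' hQ₁ hQ
      obtain ⟨hm'1, hL₁i⟩ := exists_firstUnitCoeffAt_of_X_sub_C_mul hz'' hL₁ hL
      rw [Nat.add_sub_cancel] at hQ₁i
      have h₁ := powMap_identity_of_X_sub_C_mul hQ₁ hL₁ h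
      have := ih hQ₁i hL₁i h₁
      omega
    · push Not at hcz
      exact firstUnitCoeffAt_eq_of_powMap_identity_of_no_common_zero hQ hL h
        fun z hz hQz hLz ↦ hcz z hz hQz hLz

end Summit.BirchSwinnertonDyer.BirchSwinnertonDyer.Theorems.KatzLineRigidity

end
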